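import Mathlib
import Literature.Computability.AlgebraicComplexity.StandardFamilies
import Summits.ValiantsHypothesis.ValiantsHypothesis.Theorems.ElementaryWordLengthWordLengthQPRungOne

/-!
# Crux `WordLengthQP` (stmt-ValiantsHypothesis-6623), line `Sketch` (eps-order-ladder) —
rung `q = 1`: reduction to SUMS OF EXACT WIDTH-2 PROGRAMS, and why that relaxation is `ΣΠΣ`-hard

Two typed facts about the first open rung `q = 1` of `stub_ladder_pos` (border width-2 S-affine
programs over `ℂ[ε][x̄]` of length `≤ L` with `(0,0)` entry `ε · per_n + ε² · G`), for the planners.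

* `rungOne_sumW2_of_orderOne` / `rungOne_of_sumW2Hard` — the RELAXATION.  By the one-way cascade
  normal form (`rungOne_normal_form`, p119541) an order-one program of length `L` for `f` writes
  `f` as a sum of `L` polynomials, the `t`-th being the `(0,0)` entry of the EXACT S-affine product
  `A₁ ⋯ A_{t-1} · B_t · A_{t+1} ⋯ A_L` of length `L` over `ℂ[x̄]`.  Hence hardness of `per_n` for the
  model `Σ^[L] W2(L)` ("sum of at most `L` exact width-2 S-affine programs, each of length `≤ L`")
  at quasi-polynomial `L` implies the rung `q = 1` of the ladder.

* `sumW2_of_sigmaPiSigma` — the relaxation is FRONTIER-HARD.  Every depth-3 `ΣΠΣ` expression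
  `∑_{t<T} ∏_{i<d} ℓ_{t,i}` with affine forms `ℓ_{t,i}` in `N` variables is, EXACTLY, a sum of `T`
  exact width-2 S-affine programs of length `d · (N + 2)` each: the singular block
  `T₀₁(ℓ) · E₁₀ = !![ℓ, 0; 1, 0]` is a product of `N + 2` S-affine letters and
  `(∏ᵢ !![ℓᵢ, 0; 1, 0])₀₀ = ∏ᵢ ℓᵢ`.  So `Σ^[qpoly] W2(qpoly)`-hardness of `per_n` would give
  super-quasi-polynomial `ΣΠΣ` lower bounds for the permanent over `ℂ` — beyond the state of the
  art (near-cubic, Kayal–Saha–Tavenas 2016).  Consequence for the line: rung 1 must be attacked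
  through what distinguishes order-one programs from `Σ W2` — the shared skeleton `A₁ ⋯ A_L` with
  `(∏ A)₀₀ = 0` (one walk), not through the relaxation.
-/

-- `Summit.ValiantsHypothesis.ValiantsHypothesis.…` is the tree's mandated single-conjunct layout
-- (Sub = Summit), so the duplicated namespace component is intended.
set_option linter.dupNamespace false

noncomputable section

open MvPolynomial

namespace Summit.ValiantsHypothesis.ValiantsHypothesis.Cruxes.WordLengthQP.EpsOrderLadder

/-! ### Order one ⟹ sum of `L` exact width-2 programs of length `L` -/

/-- Evaluating `ε ↦ 0` keeps a width-2 matrix over `ℂ[ε][x̄]` with S-affine entries S-affine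
(over `ℂ`). [folklore] -/
theorem rungOne_evalZero_sAffine {σ : Type}
    (m : Matrix (Fin 2) (Fin 2) (MvPolynomial σ (Polynomial ℂ)))
    (hm : ∀ i j : Fin 2, (∃ b : Polynomial ℂ, m i j = MvPolynomial.C b) ∨
      (∃ (a b : Polynomial ℂ) (v : σ),
        m i j = MvPolynomial.C a * MvPolynomial.X v + MvPolynomial.C b))
    (i j : Fin 2) :
    (∃ b : ℂ, m.map (MvPolynomial.map (Polynomial.evalRingHom 0)) i j = MvPolynomial.C b) ∨
      (∃ (a b : ℂ) (v : σ), m.map (MvPolynomial.map (Polynomial.evalRingHom 0)) i j =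
        MvPolynomial.C a * MvPolynomial.X v + MvPolynomial.C b) := by
  rcases hm i j with ⟨b, hb⟩ | ⟨a, b, v, hab⟩
  · exact Or.inl ⟨b.eval 0, by simp [Matrix.map_apply, hb, MvPolynomial.map_C]⟩
  · exact Or.inr ⟨a.eval 0, b.eval 0, v, by
      simp [Matrix.map_apply, hab, MvPolynomial.map_C, MvPolynomial.map_X]⟩

/-- **Order one ⟹ `Σ^[L] W2(L)`.**  If a product of `≤ L` width-2 matrices over `ℂ[ε][x̄]` with
S-affine entries has `(0,0)` entry `ε · f + ε² · G`, then `f` is a sum of at most `L`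
polynomials, each the `(0,0)` entry of a product of at most `L` width-2 matrices over `ℂ[x̄]`
with S-affine entries (namely `A₁⋯A_{t-1} B_t A_{t+1}⋯A_L`, `rungOne_normal_form`). -/
theorem rungOne_sumW2_of_orderOne {σ : Type} (f : MvPolynomial σ ℂ) (L : ℕ)
    (ms : List (Matrix (Fin 2) (Fin 2) (MvPolynomial σ (Polynomial ℂ))))
    (hlen : ms.length ≤ L)
    (hS : ∀ m ∈ ms, ∀ i j : Fin 2, (∃ b : Polynomial ℂ, m i j = MvPolynomial.C b) ∨
      (∃ (a b : Polynomial ℂ) (v : σ),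
        m i j = MvPolynomial.C a * MvPolynomial.X v + MvPolynomial.C b))
    (G : MvPolynomial σ (Polynomial ℂ))
    (hF : ms.prod 0 0 = MvPolynomial.C Polynomial.X * MvPolynomial.map Polynomial.C f +
      MvPolynomial.C (Polynomial.X ^ 2) * G) :
    ∃ ws : List (List (Matrix (Fin 2) (Fin 2) (MvPolynomial σ ℂ))), ws.length ≤ L ∧
      (∀ w ∈ ws, w.length ≤ L ∧ ∀ m ∈ w, ∀ i j : Fin 2, (∃ b : ℂ, m i j = MvPolynomial.C b) ∨
        (∃ (a b : ℂ) (v : σ), m i j = MvPolynomial.C a * MvPolynomial.X v + MvPolynomial.C b)) ∧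
      (ws.map (fun w => w.prod 0 0)).sum = f := by
  obtain ⟨Bs, hBlen, hBS, -, hf⟩ := rungOne_normal_form f ms hS G hF
  set As := ms.map (fun m => m.map (MvPolynomial.map (Polynomial.evalRingHom 0))) with hAs
  have hAlen : As.length = ms.length := by simp [hAs]
  have hAS : ∀ m ∈ As, ∀ i j : Fin 2, (∃ b : ℂ, m i j = MvPolynomial.C b) ∨
      (∃ (a b : ℂ) (v : σ), m i j = MvPolynomial.C a * MvPolynomial.X v + MvPolynomial.C b) := by
    intro m hm i j
    obtain ⟨m₀, hm₀, rfl⟩ := List.mem_map.1 hm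
    exact rungOne_evalZero_sAffine m₀ (hS m₀ hm₀) i j
  -- the zero matrix is S-affine, so `Bs.getD t 0` is S-affine for every `t`
  have hBgetD : ∀ t : ℕ, ∀ i j : Fin 2, (∃ b : ℂ, (Bs.getD t 0) i j = MvPolynomial.C b) ∨
      (∃ (a b : ℂ) (v : σ),
        (Bs.getD t 0) i j = MvPolynomial.C a * MvPolynomial.X v + MvPolynomial.C b) := by
    intro t i j
    rw [List.getD_eq_getElem?_getD]
    cases h : Bs[t]? with
    | none => exact Or.inl ⟨0, by simp⟩
    | some B =>
      have hB : B ∈ Bs := List.mem_of_getElem? h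
      simpa using hBS B hB i j
  refine ⟨List.ofFn (fun t : Fin ms.length => As.take t ++ [Bs.getD t 0] ++ As.drop (t + 1)),
    by simpa using hlen, ?_, ?_⟩
  · rw [List.forall_mem_ofFn_iff]
    intro t
    refine ⟨?_, fun m hm => ?_⟩
    · simp only [List.length_append, List.length_take, List.length_singleton, List.length_drop,
        hAlen]
      have := t.isLt
      omega
    · simp only [List.mem_append, List.mem_singleton] at hm
      rcases hm with (h | rfl) | h
      · exact hAS m (List.mem_of_mem_take h)
      · exact hBgetD t
      · exact hAS m (List.mem_of_mem_drop h)
  · rw [List.map_ofFn, List.sum_ofFn, hf, Matrix.sum_apply,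
      ← Fin.sum_univ_eq_sum_range (fun t => ((As.take t).prod * Bs.getD t 0 *
        (As.drop (t + 1)).prod) 0 0) ms.length]
    refine Finset.sum_congr rfl fun t _ => ?_
    simp [List.prod_append, Matrix.mul_assoc]

/-- **The rung `q = 1` of the ladder from `Σ W2`-hardness of the permanent.**  If for every `c`
some `n ≥ 10` has `per_n` outside `Σ^[L] W2(L)` for all `L ≤ 2^((log₂ n + c)^c)` — `per_n` is
not a sum of at most `L` polynomials each computed at the `(0,0)` entry by a product of at most
`L` width-2 S-affine matrices over `ℂ[x̄]` — then the `q = 1` slice of the open stub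
`stub_ladder_pos` holds: no border width-2 S-affine program of ε-order one and length
`≤ 2^((log₂ n + c)^c)` computes `per_n`. -/
theorem rungOne_of_sumW2Hard
    (h : ∀ c : ℕ, ∃ n : ℕ, 10 ≤ n ∧ ∀ L : ℕ, L ≤ 2 ^ ((Nat.log 2 n + c) ^ c) →
      ¬ ∃ ws : List (List (Matrix (Fin 2) (Fin 2) (MvPolynomial (Fin n × Fin n) ℂ))),
          ws.length ≤ L ∧
          (∀ w ∈ ws, w.length ≤ L ∧ ∀ m ∈ w, ∀ i j : Fin 2, (∃ b : ℂ, m i j = MvPolynomial.C b) ∨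
            (∃ (a b : ℂ) (v : Fin n × Fin n),
              m i j = MvPolynomial.C a * MvPolynomial.X v + MvPolynomial.C b)) ∧
          (ws.map (fun w => w.prod 0 0)).sum =
            Literature.Computability.AlgebraicComplexity.perPoly (Fin n) ℂ) :
    ∀ c : ℕ, ∃ n : ℕ, 10 ≤ n ∧ ∀ L : ℕ, L ≤ 2 ^ ((Nat.log 2 n + c) ^ c) →
      ¬ (∃ ms : List (Matrix (Fin 2) (Fin 2) (MvPolynomial (Fin n × Fin n) (Polynomial ℂ))),
          ms.length ≤ L ∧
          (∀ m ∈ ms, ∀ i j : Fin 2, (∃ b : Polynomial ℂ, m i j = MvPolynomial.C b) ∨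
            (∃ (a b : Polynomial ℂ) (v : Fin n × Fin n),
              m i j = MvPolynomial.C a * MvPolynomial.X v + MvPolynomial.C b)) ∧
          ∃ G : MvPolynomial (Fin n × Fin n) (Polynomial ℂ),
            ms.prod 0 0 = MvPolynomial.C (Polynomial.X ^ 1) *
                MvPolynomial.map Polynomial.C
                  (Literature.Computability.AlgebraicComplexity.perPoly (Fin n) ℂ) +
              MvPolynomial.C (Polynomial.X ^ (1 + 1)) * G) := by
  intro c
  obtain ⟨n, hn, hc⟩ := h c
  refine ⟨n, hn, fun L hL => ?_⟩
  rintro ⟨ms, hlen, hS, G, hG⟩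
  refine hc L hL ?_
  obtain ⟨ws, hwlen, hws, hsum⟩ := rungOne_sumW2_of_orderOne _ L ms hlen hS G (by simpa using hG)
  exact ⟨ws, hwlen, hws, hsum⟩

/-! ### `ΣΠΣ ⊆ Σ W2` exactly: the relaxation is depth-3-hard -/

/-- Upper transvection letters add: `(∏_{v ∈ l} T₀₁(g v)) = T₀₁(∑_{v ∈ l} g v)`. [folklore] -/
theorem sumW2_prod_T01 {σ ι : Type} (l : List ι) (g : ι → MvPolynomial σ ℂ) :
    (l.map (fun v => (!![1, g v; 0, 1] : Matrix (Fin 2) (Fin 2) (MvPolynomial σ ℂ)))).prod =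
      !![1, (l.map g).sum; 0, 1] := by
  induction l with
  | nil => simp [Matrix.one_fin_two]
  | cons v l ih =>
    rw [List.map_cons, List.prod_cons, ih, List.map_cons, List.sum_cons]
    refine Matrix.ext fun i j => ?_
    fin_cases i <;> fin_cases j <;> simp [Matrix.mul_apply, Fin.sum_univ_two, add_comm]

/-- The singular block of an affine form `ℓ = ∑_v a_v x_v + b` over a finite variable set:
the S-affine word `T₀₁(a_v x_v) (v ∈ σ) · T₀₁(b) · E₁₀` of length `|σ| + 2` multiplies to
`!![ℓ, 0; 1, 0]`. [folklore] -/
theorem sumW2_block {σ : Type} [Fintype σ] (a : σ → ℂ) (b : ℂ) :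
    ∃ w : List (Matrix (Fin 2) (Fin 2) (MvPolynomial σ ℂ)), w.length = Fintype.card σ + 2 ∧
      (∀ m ∈ w, ∀ i j : Fin 2, (∃ b : ℂ, m i j = MvPolynomial.C b) ∨
        (∃ (a b : ℂ) (v : σ), m i j = MvPolynomial.C a * MvPolynomial.X v + MvPolynomial.C b)) ∧
      w.prod = !![∑ v, MvPolynomial.C (a v) * MvPolynomial.X v + MvPolynomial.C b, 0; 1, 0] := by
  classical
  refine ⟨(Finset.univ.toList.map (fun v => (!![1, MvPolynomial.C (a v) * MvPolynomial.X v; 0, 1] :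
      Matrix (Fin 2) (Fin 2) (MvPolynomial σ ℂ)))) ++
      [!![1, MvPolynomial.C b; 0, 1], !![0, 0; 1, 0]], ?_, ?_, ?_⟩
  · simp
  · intro m hm
    simp only [List.mem_append, List.mem_map, Finset.mem_toList, Finset.mem_univ, true_and,
      List.mem_cons, List.not_mem_nil, or_false] at hm
    rcases hm with ⟨v, rfl⟩ | rfl | rfl
    · intro i j
      fin_cases i <;> fin_cases j
      · exact Or.inl ⟨1, by simp⟩
      · exact Or.inr ⟨a v, 0, v, by simp⟩
      · exact Or.inl ⟨0, by simp⟩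
      · exact Or.inl ⟨1, by simp⟩
    · intro i j
      fin_cases i <;> fin_cases j
      · exact Or.inl ⟨1, by simp⟩
      · exact Or.inl ⟨b, by simp⟩
      · exact Or.inl ⟨0, by simp⟩
      · exact Or.inl ⟨1, by simp⟩
    · intro i j
      fin_cases i <;> fin_cases j
      · exact Or.inl ⟨0, by simp⟩
      · exact Or.inl ⟨0, by simp⟩
      · exact Or.inl ⟨1, by simp⟩
      · exact Or.inl ⟨0, by simp⟩
  · rw [List.prod_append, sumW2_prod_T01, Finset.sum_map_toList]
    simp only [List.prod_cons, List.prod_nil, mul_one]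
    refine Matrix.ext fun i j => ?_
    fin_cases i <;> fin_cases j <;> simp [Matrix.mul_apply, Fin.sum_univ_two, add_comm]

/-- Products of singular blocks multiply their `(0,0)` entries and keep a zero `(0,1)` entry.
[folklore] -/
theorem sumW2_blocks_prod {σ : Type} (ls : List (MvPolynomial σ ℂ)) :
    (ls.map (fun ℓ => (!![ℓ, 0; 1, 0] : Matrix (Fin 2) (Fin 2) (MvPolynomial σ ℂ)))).prod 0 0 =
        ls.prod ∧
      (ls.map (fun ℓ => (!![ℓ, 0; 1, 0] : Matrix (Fin 2) (Fin 2) (MvPolynomial σ ℂ)))).prod 0 1 =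
        0 := by
  induction ls using List.reverseRecOn with
  | nil => simp
  | append_singleton ls ℓ ih =>
    obtain ⟨h00, h01⟩ := ih
    rw [List.map_append, List.prod_append, List.prod_append]
    simp [Matrix.mul_apply, Fin.sum_univ_two, h00, h01]

/-- **`ΣΠΣ ⊆ Σ W2`, exactly.**  Every depth-3 expression `∑_{t<T} ∏_{i<d} ℓ_{t,i}` with affine
forms `ℓ_{t,i} = ∑_v a_{t,i,v} x_v + b_{t,i}` over a finite variable set `σ` is a sum of at most
`T` polynomials, each the `(0,0)` entry of a product of at most `d · (|σ| + 2)` width-2 matrices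
over `ℂ[x̄]` with S-affine entries.  Hence `Σ^[qpoly] W2(qpoly)`-hardness of `per_n` (the
hypothesis of `rungOne_of_sumW2Hard`) implies super-quasi-polynomial `ΣΠΣ` lower bounds for the
permanent over `ℂ`. -/
theorem sumW2_of_sigmaPiSigma {σ : Type} [Fintype σ] (T d : ℕ) (a : Fin T → Fin d → σ → ℂ)
    (b : Fin T → Fin d → ℂ) :
    ∃ ws : List (List (Matrix (Fin 2) (Fin 2) (MvPolynomial σ ℂ))), ws.length ≤ T ∧
      (∀ w ∈ ws, w.length ≤ d * (Fintype.card σ + 2) ∧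
        ∀ m ∈ w, ∀ i j : Fin 2, (∃ b : ℂ, m i j = MvPolynomial.C b) ∨
          (∃ (a b : ℂ) (v : σ), m i j = MvPolynomial.C a * MvPolynomial.X v + MvPolynomial.C b)) ∧
      (ws.map (fun w => w.prod 0 0)).sum =
        ∑ t : Fin T, ∏ i : Fin d, (∑ v, MvPolynomial.C (a t i v) * MvPolynomial.X v +
          MvPolynomial.C (b t i)) := by
  classical
  -- choose the block word of every affine form
  choose w hwlen hwS hwprod using fun t i => sumW2_block (σ := σ) (a t i) (b t i)
  refine ⟨List.ofFn (fun t : Fin T => (List.ofFn (fun i : Fin d => w t i)).flatten),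
    by simp, ?_, ?_⟩
  · rw [List.forall_mem_ofFn_iff]
    intro t
    refine ⟨?_, fun m hm => ?_⟩
    · rw [List.length_flatten, List.map_ofFn, List.sum_ofFn]
      simp only [Function.comp_def, hwlen, Finset.sum_const, Finset.card_univ, Fintype.card_fin,
        smul_eq_mul]
      exact le_rfl
    · rw [List.mem_flatten] at hm
      obtain ⟨l, hl, hml⟩ := hm
      rw [List.mem_ofFn'] at hl
      obtain ⟨i, rfl⟩ := hl
      exact hwS t i m hml
  · rw [List.map_ofFn, List.sum_ofFn]
    refine Finset.sum_congr rfl fun t _ => ?_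
    simp only [Function.comp_apply]
    rw [List.prod_flatten, List.map_ofFn]
    have hfun : (List.ofFn ((fun l : List (Matrix (Fin 2) (Fin 2) (MvPolynomial σ ℂ)) => l.prod) ∘
        fun i : Fin d => w t i)) =
        (List.ofFn (fun i : Fin d => ∑ v, MvPolynomial.C (a t i v) * MvPolynomial.X v +
          MvPolynomial.C (b t i))).map
          (fun ℓ => (!![ℓ, 0; 1, 0] : Matrix (Fin 2) (Fin 2) (MvPolynomial σ ℂ))) := by
      rw [List.map_ofFn]
      congr 1
      funext i
      simp [hwprod t i]
    rw [hfun, (sumW2_blocks_prod _).1, List.prod_ofFn]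

end Summit.ValiantsHypothesis.ValiantsHypothesis.Cruxes.WordLengthQP.EpsOrderLadder
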